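import Literature.Analysis.FluidPDE.PeriodicCylinderWallFlux
import Literature.Analysis.FluidPDE.KatoLaiUniformExistenceBridge
import Literature.Analysis.Calculus.SmoothCutoff
import Mathlib.Analysis.InnerProductSpace.Calculus
import HarnessLib

/-!
# The trace inequality on the wall of the period cell of the cylinder

Topic `Literature/Analysis/FluidPDE`. For a function `φ` of class `C¹` on the closed cylinder
`{r ≤ 1}` with values in a real inner product space, the integral of `‖φ‖` over the wall
`{r = 1} × [0, L]` (surface measure `dθ dz`) is controlled by the `W^{1,1}` size of `φ` on the
period cell:

`∫_{[-π,π]×[0,L]} ‖φ(cos θ, sin θ, z)‖ d(θ,z) ≤ C ∫_{{r<1}×(0,L)} (‖φ‖ + ‖Dφ‖) dx`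

with an absolute constant `C` (`exists_wallTrace_le`: the trace theorem `W^{1,1}(Ω) → L¹(∂Ω)`,
Evans–Gariepy §4.3 Thm. 1 / the tree's `exists_eLpNorm_surfaceMeasure_le_of_contDiff` on Lipschitz
domains, in the concrete parametrised form needed on the cylinder, where the wall is flat in the
coordinates `(r, θ, z)` and no Hausdorff measure is involved). No periodicity is needed.

## Proof

With the radial weight `ρ(r) = smoothTransition (2r - 1)` (`= 0` for `r ≤ 1/2`, `ρ(1) = 1`,
`|ρ'| ≤ 2D`), Mathlib's divergence theorem on the parameter box `[0,1] × [-π,π] × [0,L]` for the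
single flux component `f₀(p) = ρ(p₀) ψ(Φ p)` (`f₁ = f₂ = 0`) gives, for a real `C¹` function `ψ`,
the identity `∫_wall ψ∘Φ(1,·) = ∫_box (ρ' ψ∘Φ + ρ Dψ(Φ p) e_r)` (`wallIntegral_eq_setIntegral_cylBox`),
whence `∫_wall ψ ≤ 2(2D+1) ∫_box r (|ψ∘Φ| + ‖Dψ∘Φ‖)` (on the support of `ρ`, `1 ≤ 2r`) and, by
the change to cylindrical coordinates (`setIntegral_cylinderCell_eq_integral_cylBoxOpen`),
`≤ 2(2D+1) ∫_cell (|ψ| + ‖Dψ‖)`. For vector-valued `φ` apply this to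
`ψ_ε = √(‖φ‖² + ε²)`, which is `C¹` with `‖φ‖ ≤ ψ_ε ≤ ‖φ‖ + ε` and `‖Dψ_ε‖ ≤ ‖Dφ‖`, and let
`ε → 0`. All statements are folklore calculus.
-/

noncomputable section

open MeasureTheory Set Function Filter Topology TopologicalSpace WithLp Real
open scoped ContDiff NNReal ENNReal InnerProductSpace RealInnerProductSpace

namespace Literature.Analysis.FluidPDE

open Literature.Analysis.Calculus (differentiable_smoothTransition deriv_smoothTransition_of_nonpos
  exists_bound_deriv_smoothTransition)

/-! ### The radial weight -/

/-- The radial weight `ρ(r) = smoothTransition (2r - 1)`: smooth, `ρ = 0` for `r ≤ 1/2`,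
`ρ(1) = 1`, `0 ≤ ρ ≤ 1`. [folklore] -/
def wallCutoff (r : ℝ) : ℝ := Real.smoothTransition (2 * r - 1)

/-- `ρ(1) = 1`. [folklore] -/
theorem wallCutoff_one : wallCutoff 1 = 1 := by
  rw [wallCutoff]; norm_num [Real.smoothTransition.one_of_one_le]

/-- `ρ(r) = 0` for `r ≤ 1/2`. [folklore] -/
theorem wallCutoff_of_le_half {r : ℝ} (hr : r ≤ 1 / 2) : wallCutoff r = 0 :=
  Real.smoothTransition.zero_of_nonpos (by linarith)

/-- `0 ≤ ρ ≤ 1`. [folklore] -/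
theorem wallCutoff_mem_Icc (r : ℝ) : wallCutoff r ∈ Icc (0 : ℝ) 1 :=
  ⟨Real.smoothTransition.nonneg _, Real.smoothTransition.le_one _⟩

/-- `ρ` is differentiable with `ρ'(r) = 2 smoothTransition'(2r - 1)`. [folklore] -/
theorem hasDerivAt_wallCutoff (r : ℝ) :
    HasDerivAt wallCutoff (2 * deriv Real.smoothTransition (2 * r - 1)) r := by
  have h1 : HasDerivAt (fun r : ℝ => 2 * r - 1) 2 r := by
    simpa using ((hasDerivAt_id r).const_mul (2 : ℝ)).sub_const 1
  have h2 := (differentiable_smoothTransition (2 * r - 1)).hasDerivAt.comp r h1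
  simp only [Function.comp_def] at h2
  show HasDerivAt (fun r : ℝ => Real.smoothTransition (2 * r - 1)) _ r
  exact h2.congr_deriv (by ring)

/-- `ρ` is differentiable. [folklore] -/
theorem differentiable_wallCutoff : Differentiable ℝ wallCutoff := fun r =>
  (hasDerivAt_wallCutoff r).differentiableAt

/-- `ρ'(r) = 0` for `r ≤ 1/2`. [folklore] -/
theorem deriv_wallCutoff_of_le_half {r : ℝ} (hr : r ≤ 1 / 2) : deriv wallCutoff r = 0 := by
  rw [(hasDerivAt_wallCutoff r).deriv, deriv_smoothTransition_of_nonpos (by linarith), mul_zero]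

/-- `ρ` is continuous. [folklore] -/
theorem continuous_wallCutoff : Continuous wallCutoff :=
  Real.smoothTransition.continuous.comp (by fun_prop)

/-- `ρ'` is continuous. [folklore] -/
theorem continuous_deriv_wallCutoff : Continuous (deriv wallCutoff) := by
  have e : deriv wallCutoff = fun r => 2 * deriv Real.smoothTransition (2 * r - 1) :=
    funext fun r => (hasDerivAt_wallCutoff r).deriv
  rw [e]
  exact continuous_const.mul
    (((Real.smoothTransition.contDiff (n := 1)).continuous_deriv le_rfl).comp (by fun_prop))

/-- A bound `|ρ'| ≤ 2D` with the bound `D` of `smoothTransition'`. [folklore] -/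
theorem exists_bound_deriv_wallCutoff : ∃ D : ℝ, 0 ≤ D ∧ ∀ r, |deriv wallCutoff r| ≤ D := by
  obtain ⟨D, hD0, hD⟩ := exists_bound_deriv_smoothTransition
  refine ⟨2 * D, by positivity, fun r => ?_⟩
  rw [(hasDerivAt_wallCutoff r).deriv, abs_mul, abs_two]
  exact mul_le_mul_of_nonneg_left (hD _) zero_le_two

/-! ### Integrability on the period cell of functions continuous on the closed cylinder -/

/-- A function continuous on the closed cylinder `{r ≤ 1}` lies in every `L^p` of the period
cell (bounded on the compact closure of the cell, which has finite measure). [folklore] -/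
theorem memLp_cylinderCell_of_continuousOn_closure {F' : Type*} [NormedAddCommGroup F'] (L : ℝ)
    (q : ℝ≥0∞) {f : EuclideanSpace ℝ (Fin 3) → F'}
    (hf : ContinuousOn f (closure (unitCylinder : Set (EuclideanSpace ℝ (Fin 3))))) :
    MemLp f q (volume.restrict (cylinderCell L : Set (EuclideanSpace ℝ (Fin 3)))) :=
  ⟨(hf.mono (subset_closure.trans (closure_cylinderCell_subset L))).aestronglyMeasurable
      (cylinderCell L).isOpen.measurableSet,
    eLpNorm_restrict_lt_top_of_continuousOn_isCompact (isCompact_closure_cylinderCell L)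
      subset_closure (hf.mono (closure_cylinderCell_subset L)) q⟩

/-- A function continuous on the closed cylinder `{r ≤ 1}` is integrable on the period cell.
[folklore] -/
theorem integrableOn_cylinderCell_of_continuousOn_closure {F' : Type*} [NormedAddCommGroup F']
    (L : ℝ) {f : EuclideanSpace ℝ (Fin 3) → F'}
    (hf : ContinuousOn f (closure (unitCylinder : Set (EuclideanSpace ℝ (Fin 3))))) :
    IntegrableOn f (cylinderCell L : Set (EuclideanSpace ℝ (Fin 3))) volume :=
  memLp_one_iff_integrable.1 (memLp_cylinderCell_of_continuousOn_closure L 1 hf)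

/-! ### The weighted radial flux and the wall identity -/

section Scalar

variable {ψ : EuclideanSpace ℝ (Fin 3) → ℝ} {L : ℝ}

/-- The single flux component `f₀(p) = ρ(p₀) ψ(Φ p)` and `f₁ = f₂ = 0`. [folklore] -/
def wallTraceFlux (ψ : EuclideanSpace ℝ (Fin 3) → ℝ) : Fin 3 → (Fin 3 → ℝ) → ℝ :=
  ![fun p => wallCutoff (p 0) * ψ (cylCoord p), 0, 0]

/-- The radial component `f₀ = ρ(r) ψ∘Φ`. [folklore] -/
@[simp] theorem wallTraceFlux_zero (ψ : EuclideanSpace ℝ (Fin 3) → ℝ) (p : Fin 3 → ℝ) :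
    wallTraceFlux ψ 0 p = wallCutoff (p 0) * ψ (cylCoord p) := rfl

/-- The angular component vanishes. [folklore] -/
@[simp] theorem wallTraceFlux_one (ψ : EuclideanSpace ℝ (Fin 3) → ℝ) : wallTraceFlux ψ 1 = 0 := rfl

/-- The axial component vanishes. [folklore] -/
@[simp] theorem wallTraceFlux_two (ψ : EuclideanSpace ℝ (Fin 3) → ℝ) : wallTraceFlux ψ 2 = 0 := rfl

/-- `∂_r f₀ = ρ'(r) ψ(Φ p) + ρ(r) Dψ(Φ p) e_r` along the `r`-line. [folklore] -/
theorem hasDerivAt_wallTraceFlux_zero_line {ψ' : EuclideanSpace ℝ (Fin 3) →L[ℝ] ℝ}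
    {p : Fin 3 → ℝ} (hψ : HasFDerivAt ψ ψ' (cylCoord p)) :
    HasDerivAt (fun s : ℝ => wallTraceFlux ψ 0 (p + s • Pi.single 0 1))
      (deriv wallCutoff (p 0) * ψ (cylCoord p) + wallCutoff (p 0) * ψ' (frameR (p 1)))
      (0 : ℝ) := by
  have hfun : (fun s : ℝ => wallTraceFlux ψ 0 (p + s • Pi.single 0 1)) =
      fun s : ℝ => wallCutoff (p 0 + s) * ψ (cylCoord p + s • frameR (p 1)) := by
    funext s
    rw [wallTraceFlux_zero, cylCoord_add_smul_single_zero]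
    simp
  rw [hfun]
  have hγ : HasDerivAt (fun s : ℝ => cylCoord p + s • frameR (p 1)) (frameR (p 1)) 0 := by
    simpa using ((hasDerivAt_id (0 : ℝ)).smul_const (frameR (p 1))).const_add (cylCoord p)
  have hψγ : HasDerivAt (fun s : ℝ => ψ (cylCoord p + s • frameR (p 1))) (ψ' (frameR (p 1))) 0 :=
    hψ.comp_hasDerivAt_of_eq 0 hγ (by simp)
  have hρ : HasDerivAt (fun s : ℝ => wallCutoff (p 0 + s)) (deriv wallCutoff (p 0)) 0 := by
    have h := (hasDerivAt_wallCutoff (p 0 + 0)).comp_const_add (p 0) 0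
    rw [add_zero] at h
    rw [(hasDerivAt_wallCutoff (p 0)).deriv]
    exact h
  have hmul := hρ.mul hψγ
  refine hmul.congr_deriv ?_
  simp

/-- **The wall integral as a box integral**: for a real `ψ` of class `C¹` on the closed cylinder
and `L ≥ 0`,
`∫_{[-π,π]×[0,L]} ψ(Φ(1,θ,z)) d(θ,z) = ∫_{[0,1]×[-π,π]×[0,L]} (ρ'(r) ψ(Φ p) + ρ(r) Dψ(Φ p) e_r(θ)) dp`
(divergence theorem on the box for `(ρ ψ∘Φ, 0, 0)`; the `r = 0` face vanishes as `ρ(0) = 0`,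
the wall face carries `ρ(1) ψ = ψ`). Here `Dψ` is `fderivWithin` on the closed cylinder, which
agrees with `fderiv` inside. [folklore] -/
theorem wallIntegral_eq_setIntegral_cylBox (hL : 0 ≤ L)
    (hψ : ContDiffOn ℝ 1 ψ (closure (unitCylinder : Set (EuclideanSpace ℝ (Fin 3))))) :
    ∫ y in cylWall L, ψ (cylCoord (Fin.insertNth 0 (1 : ℝ) y)) =
      ∫ p in cylBox L, (deriv wallCutoff (p 0) * ψ (cylCoord p) + wallCutoff (p 0) *
        fderivWithin ℝ ψ (closure (unitCylinder : Set (EuclideanSpace ℝ (Fin 3)))) (cylCoord p)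
          (frameR (p 1))) := by
  set K : Set (EuclideanSpace ℝ (Fin 3)) := closure (unitCylinder : Set (EuclideanSpace ℝ (Fin 3)))
    with hK
  have hKu : UniqueDiffOn ℝ K := uniqueDiffOn_closure_unitCylinder
  have hKn : ∀ p ∈ cylBoxOpen L, K ∈ 𝓝 (cylCoord p) := fun p hp =>
    mem_of_superset (unitCylinder.isOpen.mem_nhds (cylCoord_mem_of_mem_cylBoxOpen hp))
      subset_closure
  have hψd : ∀ p ∈ cylBoxOpen L, HasFDerivAt ψ (fderivWithin ℝ ψ K (cylCoord p)) (cylCoord p) :=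
    fun p hp => by
    have hdw : DifferentiableWithinAt ℝ ψ K (cylCoord p) :=
      hψ.differentiableOn one_ne_zero _ (subset_closure (cylCoord_mem_of_mem_cylBoxOpen hp))
    have hd : DifferentiableAt ℝ ψ (cylCoord p) := hdw.differentiableAt (hKn p hp)
    rw [fderivWithin_of_mem_nhds (hKn p hp)]
    exact hd.hasFDerivAt
  -- the continuous divergence on the closed box
  set g : (Fin 3 → ℝ) → ℝ := fun p => deriv wallCutoff (p 0) * ψ (cylCoord p) +
    wallCutoff (p 0) * fderivWithin ℝ ψ K (cylCoord p) (frameR (p 1)) with hg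
  have hψc : ContinuousOn (fun p => ψ (cylCoord p)) (cylBox L) :=
    hψ.continuousOn.comp continuous_cylCoord.continuousOn
      fun p hp => cylCoord_mem_closure_of_mem_cylBox hp
  have hgc : ContinuousOn g (cylBox L) := by
    have hD : ContinuousOn (fun p => fderivWithin ℝ ψ K (cylCoord p)) (cylBox L) :=
      (hψ.continuousOn_fderivWithin hKu le_rfl).comp continuous_cylCoord.continuousOn
        fun p hp => cylCoord_mem_closure_of_mem_cylBox hp
    have h0 : Continuous fun p : Fin 3 → ℝ => p 0 := continuous_apply 0
    have h1 : Continuous fun p : Fin 3 → ℝ => p 1 := continuous_apply 1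
    refine ((continuous_deriv_wallCutoff.comp h0).continuousOn.mul hψc).add
      ((continuous_wallCutoff.comp h0).continuousOn.mul
        (hD.clm_apply (contDiff_frameR.continuous.comp h1).continuousOn))
  have hgi : IntegrableOn g (cylBox L) := hgc.integrableOn_compact isCompact_Icc
  -- differentiability of the flux components on the open box and the divergence
  have hdiff : ∀ p ∈ cylBoxOpen L, ∀ i, DifferentiableAt ℝ (wallTraceFlux ψ i) p := by
    intro p hp i
    have hc : DifferentiableAt ℝ cylCoord p := (contDiff_cylCoord.differentiable (by simp)) p
    have hψc' : DifferentiableAt ℝ (fun q => ψ (cylCoord q)) p :=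
      (hψd p hp).differentiableAt.comp p hc
    have h0 : DifferentiableAt ℝ (fun q : Fin 3 → ℝ => wallCutoff (q 0)) p := by
      apply DifferentiableAt.comp (g := wallCutoff) p
      · exact differentiable_wallCutoff _
      · exact differentiableAt_apply 0 p
    fin_cases i
    · exact h0.mul hψc'
    · exact differentiableAt_const _
    · exact differentiableAt_const _
  have heq : ∀ p ∈ cylBoxOpen L,
      ∑ i, fderiv ℝ (wallTraceFlux ψ i) p (Pi.single i 1) = g p := fun p hp => by
    rw [Fin.sum_univ_three,
      fderiv_apply_single_eq_of_hasDerivAt_line (hdiff p hp 0)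
        (hasDerivAt_wallTraceFlux_zero_line (hψd p hp))]
    simp [hg]
  -- the divergence theorem on the box
  have hDT := integral_divergence_of_hasFDerivAt_off_countable' cylBoxLo (cylBoxHi L)
    (cylBoxLo_le_cylBoxHi hL) (wallTraceFlux ψ) (fun i p => fderiv ℝ (wallTraceFlux ψ i) p) ∅
    countable_empty
    (by
      intro i
      fin_cases i
      · exact ((continuous_wallCutoff.comp (continuous_apply 0)).continuousOn.mul hψc)
      · exact continuousOn_const
      · exact continuousOn_const)
    (fun p hp i => (hdiff p hp.1 i).hasFDerivAt)
    (hgi.congr_fun_ae (ae_restrict_cylBox_of_forall fun p hp => (heq p hp).symm))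
  -- the faces
  have hfaces : ∑ i : Fin 3,
      ((∫ y in Icc (cylBoxLo ∘ Fin.succAbove i) (cylBoxHi L ∘ Fin.succAbove i),
          wallTraceFlux ψ i (Fin.insertNth i (cylBoxHi L i) y)) -
        ∫ y in Icc (cylBoxLo ∘ Fin.succAbove i) (cylBoxHi L ∘ Fin.succAbove i),
          wallTraceFlux ψ i (Fin.insertNth i (cylBoxLo i) y)) =
      ∫ y in cylWall L, ψ (cylCoord (Fin.insertNth 0 (1 : ℝ) y)) := by
    have hw1 : ∀ y : Fin 2 → ℝ, wallTraceFlux ψ 0 (Fin.insertNth 0 (cylBoxHi L 0) y) =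
        ψ (cylCoord (Fin.insertNth 0 (1 : ℝ) y)) := fun y => by
      obtain ⟨h0, -, -⟩ := insertNth_zero_one_apply y
      rw [cylBoxHi_zero, wallTraceFlux_zero, h0, wallCutoff_one, one_mul]
    have hw0 : ∀ y : Fin 2 → ℝ, wallTraceFlux ψ 0 (Fin.insertNth 0 (cylBoxLo 0) y) = 0 := fun y => by
      rw [cylBoxLo_zero, wallTraceFlux_zero]
      simp [wallCutoff_of_le_half (by norm_num : (0 : ℝ) ≤ 1 / 2)]
    rw [Fin.sum_univ_three]
    simp only [hw1, hw0, wallTraceFlux_one, wallTraceFlux_two, Pi.zero_apply, integral_zero,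
      sub_self, add_zero, sub_zero]
    rfl
  rw [← hfaces, ← hDT]
  exact integral_congr_ae (ae_restrict_cylBox_of_forall fun p hp => heq p hp)

/-- **The trace inequality on the wall for a real `C¹` function, box form**:
`∫_wall ψ∘Φ(1,·) ≤ 2(2D+1) ∫_box r (|ψ(Φ p)| + ‖Dψ(Φ p)‖)` where `D` bounds `|ρ'|` (on the
support of `ρ`, `1 ≤ 2r`; `‖e_r‖ = 1`). [folklore] -/
theorem wallIntegral_le_setIntegral_cylBox {D : ℝ} (hD0 : 0 ≤ D)
    (hD : ∀ r, |deriv wallCutoff r| ≤ D) (hL : 0 ≤ L)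
    (hψ : ContDiffOn ℝ 1 ψ (closure (unitCylinder : Set (EuclideanSpace ℝ (Fin 3))))) :
    ∫ y in cylWall L, ψ (cylCoord (Fin.insertNth 0 (1 : ℝ) y)) ≤
      2 * (D + 1) * ∫ p in cylBox L, p 0 * (|ψ (cylCoord p)| +
        ‖fderivWithin ℝ ψ (closure (unitCylinder : Set (EuclideanSpace ℝ (Fin 3)))) (cylCoord p)‖) := by
  set K : Set (EuclideanSpace ℝ (Fin 3)) := closure (unitCylinder : Set (EuclideanSpace ℝ (Fin 3)))
    with hK
  rw [wallIntegral_eq_setIntegral_cylBox hL hψ, ← integral_const_mul]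
  have hKu : UniqueDiffOn ℝ K := uniqueDiffOn_closure_unitCylinder
  -- continuity, hence integrability, of both integrands on the compact box
  have hψc : ContinuousOn (fun p => ψ (cylCoord p)) (cylBox L) :=
    hψ.continuousOn.comp continuous_cylCoord.continuousOn
      fun p hp => cylCoord_mem_closure_of_mem_cylBox hp
  have hDc : ContinuousOn (fun p => fderivWithin ℝ ψ K (cylCoord p)) (cylBox L) :=
    (hψ.continuousOn_fderivWithin hKu le_rfl).comp continuous_cylCoord.continuousOn
      fun p hp => cylCoord_mem_closure_of_mem_cylBox hp
  have h0 : Continuous fun p : Fin 3 → ℝ => p 0 := continuous_apply 0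
  have h1 : Continuous fun p : Fin 3 → ℝ => p 1 := continuous_apply 1
  have hlc : ContinuousOn (fun p : Fin 3 → ℝ => deriv wallCutoff (p 0) * ψ (cylCoord p) +
      wallCutoff (p 0) * fderivWithin ℝ ψ K (cylCoord p) (frameR (p 1))) (cylBox L) :=
    ((continuous_deriv_wallCutoff.comp h0).continuousOn.mul hψc).add
      ((continuous_wallCutoff.comp h0).continuousOn.mul
        (hDc.clm_apply (contDiff_frameR.continuous.comp h1).continuousOn))
  have hrc : ContinuousOn (fun p : Fin 3 → ℝ => 2 * (D + 1) * (p 0 * (|ψ (cylCoord p)| +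
      ‖fderivWithin ℝ ψ K (cylCoord p)‖))) (cylBox L) :=
    continuousOn_const.mul (h0.continuousOn.mul (hψc.abs.add hDc.norm))
  refine setIntegral_mono_on (hlc.integrableOn_compact isCompact_Icc)
    (hrc.integrableOn_compact isCompact_Icc) measurableSet_Icc fun p hp => ?_
  -- the pointwise bound
  have hr : p 0 ∈ Icc (0 : ℝ) 1 := radius_mem_of_mem_cylBox hp
  have hframe : ‖frameR (p 1)‖ = 1 := by
    rw [← frameBasis_apply_zero (p 1)]
    exact (frameBasis (p 1)).orthonormal.norm_eq_one 0
  by_cases hhalf : p 0 ≤ 1 / 2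
  · rw [wallCutoff_of_le_half hhalf, deriv_wallCutoff_of_le_half hhalf]
    simp only [zero_mul, add_zero]
    have : 0 ≤ p 0 * (|ψ (cylCoord p)| + ‖fderivWithin ℝ ψ K (cylCoord p)‖) :=
      mul_nonneg hr.1 (by positivity)
    positivity
  · push Not at hhalf
    have hρ := wallCutoff_mem_Icc (p 0)
    have hρ' := hD (p 0)
    have hA : |deriv wallCutoff (p 0) * ψ (cylCoord p)| ≤ D * |ψ (cylCoord p)| := by
      rw [abs_mul]; exact mul_le_mul_of_nonneg_right hρ' (abs_nonneg _)
    have hB : |wallCutoff (p 0) * fderivWithin ℝ ψ K (cylCoord p) (frameR (p 1))| ≤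
        ‖fderivWithin ℝ ψ K (cylCoord p)‖ := by
      rw [abs_mul, abs_of_nonneg hρ.1]
      calc wallCutoff (p 0) * |fderivWithin ℝ ψ K (cylCoord p) (frameR (p 1))|
          ≤ 1 * ‖fderivWithin ℝ ψ K (cylCoord p) (frameR (p 1))‖ := by
            rw [← Real.norm_eq_abs]; exact mul_le_mul_of_nonneg_right hρ.2 (norm_nonneg _)
        _ ≤ ‖fderivWithin ℝ ψ K (cylCoord p)‖ := by
            rw [one_mul]
            calc ‖fderivWithin ℝ ψ K (cylCoord p) (frameR (p 1))‖
                ≤ ‖fderivWithin ℝ ψ K (cylCoord p)‖ * ‖frameR (p 1)‖ :=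
                  ContinuousLinearMap.le_opNorm _ _
              _ = ‖fderivWithin ℝ ψ K (cylCoord p)‖ := by rw [hframe, mul_one]
    have hsum := (abs_add_le _ _).trans (add_le_add hA hB)
    have hψ0 : 0 ≤ |ψ (cylCoord p)| := abs_nonneg _
    have hD0' : 0 ≤ ‖fderivWithin ℝ ψ K (cylCoord p)‖ := norm_nonneg _
    calc deriv wallCutoff (p 0) * ψ (cylCoord p) +
          wallCutoff (p 0) * fderivWithin ℝ ψ K (cylCoord p) (frameR (p 1))
        ≤ D * |ψ (cylCoord p)| + ‖fderivWithin ℝ ψ K (cylCoord p)‖ := (le_abs_self _).trans hsum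
      _ ≤ (D + 1) * (|ψ (cylCoord p)| + ‖fderivWithin ℝ ψ K (cylCoord p)‖) := by nlinarith
      _ ≤ (D + 1) * (2 * p 0) * (|ψ (cylCoord p)| + ‖fderivWithin ℝ ψ K (cylCoord p)‖) := by
          have h2 : (1 : ℝ) ≤ 2 * p 0 := by linarith
          have hpos : 0 ≤ (D + 1) * (|ψ (cylCoord p)| + ‖fderivWithin ℝ ψ K (cylCoord p)‖) := by
            positivity
          nlinarith
      _ = 2 * (D + 1) * (p 0 * (|ψ (cylCoord p)| + ‖fderivWithin ℝ ψ K (cylCoord p)‖)) := by ring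

/-- **The trace inequality on the wall for a real `C¹` function**: for `ψ` of class `C¹` on the
closed cylinder and `L ≥ 0`,
`∫_{[-π,π]×[0,L]} ψ(cos θ, sin θ, z) d(θ,z) ≤ 2(2D+1) ∫_{{r<1}×(0,L)} (|ψ| + ‖Dψ‖) dx`, `D` the
bound of `ρ'`. [folklore] -/
theorem wallIntegral_le_setIntegral_cylinderCell {D : ℝ} (hD0 : 0 ≤ D)
    (hD : ∀ r, |deriv wallCutoff r| ≤ D) (hL : 0 ≤ L)
    (hψ : ContDiffOn ℝ 1 ψ (closure (unitCylinder : Set (EuclideanSpace ℝ (Fin 3))))) :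
    ∫ y in cylWall L, ψ (cylCoord (Fin.insertNth 0 (1 : ℝ) y)) ≤
      2 * (D + 1) * ∫ x in (cylinderCell L : Set (EuclideanSpace ℝ (Fin 3))),
        (|ψ x| + ‖fderiv ℝ ψ x‖) := by
  set K : Set (EuclideanSpace ℝ (Fin 3)) := closure (unitCylinder : Set (EuclideanSpace ℝ (Fin 3)))
    with hK
  have hae : cylBoxOpen L =ᵐ[volume] cylBox L := by
    rw [volume_pi]; exact Measure.univ_pi_Ioo_ae_eq_Icc
  have hcv := setIntegral_cylinderCell_eq_integral_cylBoxOpen L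
    (fun x => |ψ x| + ‖fderivWithin ℝ ψ K x‖)
  have hcell : ∫ x in (cylinderCell L : Set (EuclideanSpace ℝ (Fin 3))), (|ψ x| + ‖fderiv ℝ ψ x‖) =
      ∫ x in (cylinderCell L : Set (EuclideanSpace ℝ (Fin 3))), (|ψ x| + ‖fderivWithin ℝ ψ K x‖) := by
    refine setIntegral_congr_fun (cylinderCell L).isOpen.measurableSet fun x hx => ?_
    have hxK : K ∈ 𝓝 x := mem_of_superset
      (unitCylinder.isOpen.mem_nhds (cylinderCell_le_unitCylinder L hx)) subset_closure
    rw [fderivWithin_of_mem_nhds hxK]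
  rw [hcell, hcv, setIntegral_congr_set hae]
  simp only [smul_eq_mul]
  exact wallIntegral_le_setIntegral_cylBox hD0 hD hL hψ

end Scalar

/-! ### Vector-valued functions -/

section Vector

variable {F : Type*} [NormedAddCommGroup F] [InnerProductSpace ℝ F]

/-- The regularised norm `√(‖φ‖² + ε²)` of a `C¹` map is `C¹`, lies between `‖φ‖` and `‖φ‖ + ε`,
and its derivative is bounded by `‖Dφ‖` — at a point of differentiability of `φ`. [folklore] -/
theorem norm_fderiv_sqrt_norm_sq_add_le {φ : EuclideanSpace ℝ (Fin 3) → F}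
    {x : EuclideanSpace ℝ (Fin 3)} (hφ : DifferentiableAt ℝ φ x) {ε : ℝ} (hε : 0 < ε) :
    ‖fderiv ℝ (fun y => Real.sqrt (‖φ y‖ ^ 2 + ε ^ 2)) x‖ ≤ ‖fderiv ℝ φ x‖ := by
  set u : EuclideanSpace ℝ (Fin 3) → ℝ := fun y => ‖φ y‖ ^ 2 + ε ^ 2 with hu
  have hux : 0 < u x := by positivity
  have hu' : HasFDerivAt u (2 • (innerSL ℝ (φ x)).comp (fderiv ℝ φ x)) x := by
    have h := hφ.hasFDerivAt.norm_sq
    simpa [hu] using h.add_const (ε ^ 2)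
  have hs := hu'.sqrt hux.ne'
  have hsq : Real.sqrt (u x) ≠ 0 := (Real.sqrt_pos.2 hux).ne'
  have hφle : ‖φ x‖ ≤ Real.sqrt (u x) := by
    rw [hu]; dsimp only
    calc ‖φ x‖ = Real.sqrt (‖φ x‖ ^ 2) := (Real.sqrt_sq (norm_nonneg _)).symm
      _ ≤ Real.sqrt (‖φ x‖ ^ 2 + ε ^ 2) := Real.sqrt_le_sqrt (by nlinarith)
  set T : EuclideanSpace ℝ (Fin 3) →L[ℝ] ℝ := (innerSL ℝ (φ x)).comp (fderiv ℝ φ x) with hT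
  have e2 : (2 : ℕ) • T = (2 : ℝ) • T := by rw [two_smul, two_smul]
  have hT' : ‖T‖ ≤ ‖φ x‖ * ‖fderiv ℝ φ x‖ :=
    calc ‖T‖ ≤ ‖innerSL ℝ (φ x)‖ * ‖fderiv ℝ φ x‖ := ContinuousLinearMap.opNorm_comp_le _ _
      _ = ‖φ x‖ * ‖fderiv ℝ φ x‖ := by rw [innerSL_apply_norm]
  rw [hs.fderiv, e2, smul_smul, norm_smul, Real.norm_eq_abs, abs_of_pos (by positivity)]
  have hc : 1 / (2 * Real.sqrt (u x)) * 2 = 1 / Real.sqrt (u x) := by field_simp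
  rw [hc]
  calc 1 / Real.sqrt (u x) * ‖T‖
      ≤ (1 / Real.sqrt (u x)) * (‖φ x‖ * ‖fderiv ℝ φ x‖) := by gcongr
    _ ≤ (1 / Real.sqrt (u x)) * (Real.sqrt (u x) * ‖fderiv ℝ φ x‖) := by gcongr
    _ = ‖fderiv ℝ φ x‖ := by field_simp

/-- **The trace inequality on the wall of the period cell** (the trace theorem
`W^{1,1}(Ω) → L¹(∂Ω)`, Evans–Gariepy §4.3 Thm. 1, in parametrised form on the cylinder): there is
an absolute constant `C` such that for every `L ≥ 0` and every `φ` of class `C¹` on the closed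
cylinder `{r ≤ 1}` with values in a real inner product space,
`∫_{[-π,π]×[0,L]} ‖φ(cos θ, sin θ, z)‖ d(θ,z) ≤ C ∫_{{r<1}×(0,L)} (‖φ‖ + ‖Dφ‖) dx`.
Proof: the scalar inequality for `ψ_ε = √(‖φ‖² + ε²)` and `ε → 0`. [folklore] -/
theorem exists_wallTrace_le :
    ∃ C : ℝ, 0 ≤ C ∧ ∀ (L : ℝ) (_ : 0 ≤ L) (φ : EuclideanSpace ℝ (Fin 3) → F)
      (_ : ContDiffOn ℝ 1 φ (closure (unitCylinder : Set (EuclideanSpace ℝ (Fin 3))))),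
      ∫ y in cylWall L, ‖φ (cylCoord (Fin.insertNth 0 (1 : ℝ) y))‖ ≤
        C * ∫ x in (cylinderCell L : Set (EuclideanSpace ℝ (Fin 3))), (‖φ x‖ + ‖fderiv ℝ φ x‖) := by
  obtain ⟨D, hD0, hD⟩ := exists_bound_deriv_wallCutoff
  refine ⟨2 * (D + 1), by positivity, fun L hL φ hφ => ?_⟩
  set K : Set (EuclideanSpace ℝ (Fin 3)) := closure (unitCylinder : Set (EuclideanSpace ℝ (Fin 3)))
    with hK
  set C : ℝ := 2 * (D + 1) with hC
  have hC0 : 0 ≤ C := by positivity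
  -- volume of the cell is finite
  have hvol : volume (cylinderCell L : Set (EuclideanSpace ℝ (Fin 3))) < ⊤ :=
    (measure_mono subset_closure).trans_lt (isCompact_closure_cylinderCell L).measure_lt_top
  set V : ℝ := (volume (cylinderCell L : Set (EuclideanSpace ℝ (Fin 3)))).toReal with hV
  -- the right-hand side integrand is integrable on the cell (continuous and bounded)
  have hKu : UniqueDiffOn ℝ K := uniqueDiffOn_closure_unitCylinder
  have hcellK : (cylinderCell L : Set (EuclideanSpace ℝ (Fin 3))) ⊆ K := fun x hx =>
    subset_closure (cylinderCell_le_unitCylinder L hx)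
  have hnhds : ∀ x ∈ (cylinderCell L : Set (EuclideanSpace ℝ (Fin 3))), K ∈ 𝓝 x := fun x hx =>
    mem_of_superset (unitCylinder.isOpen.mem_nhds (cylinderCell_le_unitCylinder L hx)) subset_closure
  have hfd : ∀ x ∈ (cylinderCell L : Set (EuclideanSpace ℝ (Fin 3))),
      fderiv ℝ φ x = fderivWithin ℝ φ K x := fun x hx => (fderivWithin_of_mem_nhds (hnhds x hx)).symm
  refine le_of_forall_pos_le_add fun δ hδ => ?_
  -- choose `ε` with `C * ε * V ≤ δ`
  obtain ⟨ε, hε, hεδ⟩ : ∃ ε : ℝ, 0 < ε ∧ C * (ε * V) ≤ δ := by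
    refine ⟨δ / (C * V + 1), div_pos hδ (by positivity), ?_⟩
    have hV0 : 0 ≤ V := ENNReal.toReal_nonneg
    rw [show C * (δ / (C * V + 1) * V) = δ * (C * V / (C * V + 1)) by ring]
    calc δ * (C * V / (C * V + 1)) ≤ δ * 1 := by
          gcongr; rw [div_le_one (by positivity)]; linarith
      _ = δ := mul_one δ
  set ψ : EuclideanSpace ℝ (Fin 3) → ℝ := fun y => Real.sqrt (‖φ y‖ ^ 2 + ε ^ 2) with hψ_def
  have hψC : ContDiffOn ℝ 1 ψ K := by
    refine ContDiffOn.sqrt ((hφ.norm_sq (𝕜 := ℝ)).add contDiffOn_const) fun y _ => ?_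
    positivity
  have hφψ : ∀ y, ‖φ y‖ ≤ ψ y := fun y => by
    calc ‖φ y‖ = Real.sqrt (‖φ y‖ ^ 2) := (Real.sqrt_sq (norm_nonneg _)).symm
      _ ≤ ψ y := Real.sqrt_le_sqrt (by nlinarith)
  have hψφ : ∀ y, ψ y ≤ ‖φ y‖ + ε := fun y => by
    rw [hψ_def]; dsimp only
    rw [Real.sqrt_le_left (by positivity)]
    nlinarith [norm_nonneg (φ y)]
  have hψ0 : ∀ y, 0 ≤ ψ y := fun y => Real.sqrt_nonneg _
  -- the scalar inequality for `ψ`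
  have hmain := wallIntegral_le_setIntegral_cylinderCell hD0 hD hL hψC
  -- compare the wall integrands and the cell integrands
  have hwall : ∫ y in cylWall L, ‖φ (cylCoord (Fin.insertNth 0 (1 : ℝ) y))‖ ≤
      ∫ y in cylWall L, ψ (cylCoord (Fin.insertNth 0 (1 : ℝ) y)) := by
    have hwc : IsCompact (cylWall L) := by rw [cylWall_eq]; exact isCompact_Icc
    have hmaps : ∀ y ∈ cylWall L, cylCoord (Fin.insertNth 0 (1 : ℝ) y) ∈ K := fun y hy => by
      refine cylCoord_mem_closure ?_ ?_ <;> simp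
    have hcont : Continuous fun y : Fin 2 → ℝ => cylCoord (Fin.insertNth 0 (1 : ℝ) y) := by
      simp_rw [cylCoord_insertNth_zero_one]
      exact (contDiff_frameR.continuous.comp (continuous_apply 0)).add
        ((continuous_apply 1).smul continuous_const)
    have hφw : ContinuousOn (fun y : Fin 2 → ℝ => ‖φ (cylCoord (Fin.insertNth 0 (1 : ℝ) y))‖)
        (cylWall L) := (hφ.continuousOn.comp hcont.continuousOn hmaps).norm
    have hψw : ContinuousOn (fun y : Fin 2 → ℝ => ψ (cylCoord (Fin.insertNth 0 (1 : ℝ) y)))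
        (cylWall L) := hψC.continuousOn.comp hcont.continuousOn hmaps
    have hwm : MeasurableSet (cylWall L) := by rw [cylWall_eq]; exact measurableSet_Icc
    exact setIntegral_mono_on (hφw.integrableOn_compact hwc) (hψw.integrableOn_compact hwc) hwm
      fun y _ => hφψ _
  -- integrability on the cell: continuous and bounded functions on a set of finite measure
  have hbdd_int : ∀ {f : EuclideanSpace ℝ (Fin 3) → ℝ}, ContinuousOn f K →
      IntegrableOn f (cylinderCell L : Set (EuclideanSpace ℝ (Fin 3))) volume := fun hf =>
    integrableOn_cylinderCell_of_continuousOn_closure L hf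
  have hφK : ContinuousOn (fun x => ‖φ x‖ + ‖fderivWithin ℝ φ K x‖) K :=
    hφ.continuousOn.norm.add (hφ.continuousOn_fderivWithin hKu le_rfl).norm
  have hψK : ContinuousOn (fun x => |ψ x| + ‖fderivWithin ℝ ψ K x‖) K :=
    hψC.continuousOn.abs.add (hψC.continuousOn_fderivWithin hKu le_rfl).norm
  have hI1 : ∫ x in (cylinderCell L : Set (EuclideanSpace ℝ (Fin 3))), (|ψ x| + ‖fderiv ℝ ψ x‖) ≤
      ∫ x in (cylinderCell L : Set (EuclideanSpace ℝ (Fin 3))), (‖φ x‖ + ‖fderiv ℝ φ x‖ + ε) := by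
    have hψfd : ∀ x ∈ (cylinderCell L : Set (EuclideanSpace ℝ (Fin 3))),
        fderiv ℝ ψ x = fderivWithin ℝ ψ K x := fun x hx => (fderivWithin_of_mem_nhds (hnhds x hx)).symm
    have e1 : ∫ x in (cylinderCell L : Set (EuclideanSpace ℝ (Fin 3))), (|ψ x| + ‖fderiv ℝ ψ x‖) =
        ∫ x in (cylinderCell L : Set (EuclideanSpace ℝ (Fin 3))), (|ψ x| + ‖fderivWithin ℝ ψ K x‖) :=
      setIntegral_congr_fun (cylinderCell L).isOpen.measurableSet fun x hx => by
        simp only [hψfd x hx]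
    have e2 : ∫ x in (cylinderCell L : Set (EuclideanSpace ℝ (Fin 3))), (‖φ x‖ + ‖fderiv ℝ φ x‖ + ε) =
        ∫ x in (cylinderCell L : Set (EuclideanSpace ℝ (Fin 3))),
          (‖φ x‖ + ‖fderivWithin ℝ φ K x‖ + ε) :=
      setIntegral_congr_fun (cylinderCell L).isOpen.measurableSet fun x hx => by
        simp only [hfd x hx]
    rw [e1, e2]
    refine setIntegral_mono_on (hbdd_int hψK) ((hbdd_int hφK).add (integrableOn_const hvol.ne))
      (cylinderCell L).isOpen.measurableSet fun x hx => ?_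
    have hd : ‖fderivWithin ℝ ψ K x‖ ≤ ‖fderivWithin ℝ φ K x‖ := by
      rw [← hψfd x hx, ← hfd x hx]
      exact norm_fderiv_sqrt_norm_sq_add_le
        (((hφ.differentiableOn one_ne_zero) x (hcellK hx)).differentiableAt (hnhds x hx)) hε
    rw [abs_of_nonneg (hψ0 x)]
    linarith [hψφ x]
  have hI2 : ∫ x in (cylinderCell L : Set (EuclideanSpace ℝ (Fin 3))), (‖φ x‖ + ‖fderiv ℝ φ x‖ + ε) =
      (∫ x in (cylinderCell L : Set (EuclideanSpace ℝ (Fin 3))), (‖φ x‖ + ‖fderiv ℝ φ x‖)) + ε * V := by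
    have hint : IntegrableOn (fun x => ‖φ x‖ + ‖fderiv ℝ φ x‖)
        (cylinderCell L : Set (EuclideanSpace ℝ (Fin 3))) volume :=
      (hbdd_int hφK).congr_fun (fun x hx => by rw [hfd x hx]) (cylinderCell L).isOpen.measurableSet
    rw [integral_add hint (integrableOn_const hvol.ne), setIntegral_const, hV, smul_eq_mul, mul_comm]
    rfl
  calc ∫ y in cylWall L, ‖φ (cylCoord (Fin.insertNth 0 (1 : ℝ) y))‖
      ≤ ∫ y in cylWall L, ψ (cylCoord (Fin.insertNth 0 (1 : ℝ) y)) := hwall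
    _ ≤ C * ∫ x in (cylinderCell L : Set (EuclideanSpace ℝ (Fin 3))), (|ψ x| + ‖fderiv ℝ ψ x‖) := hmain
    _ ≤ C * ∫ x in (cylinderCell L : Set (EuclideanSpace ℝ (Fin 3))), (‖φ x‖ + ‖fderiv ℝ φ x‖ + ε) :=
        mul_le_mul_of_nonneg_left hI1 hC0
    _ = C * (∫ x in (cylinderCell L : Set (EuclideanSpace ℝ (Fin 3))), (‖φ x‖ + ‖fderiv ℝ φ x‖)) +
          C * (ε * V) := by rw [hI2, mul_add]
    _ ≤ C * (∫ x in (cylinderCell L : Set (EuclideanSpace ℝ (Fin 3))), (‖φ x‖ + ‖fderiv ℝ φ x‖)) +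
          δ := add_le_add le_rfl hεδ

end Vector

end Literature.Analysis.FluidPDE
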